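import Summits.BirchSwinnertonDyer.BirchSwinnertonDyer.Theorems.ClassRecordThreeCornerAtThreeShimuraFamilyH47Orders
import HarnessLib

/-!
# McCallum 1991 Prop. 4.4 in ORDER form — the producer `h47` AT A GENERAL LEVEL GUARD `N'` (genus line (b2b-κ); helper,
# `--supports 23444`)

Cell bsd-stepL, prover seat `bsd-stepL-imc-p1` g42 (idle hand on the genus line of crux 23444, pen 15:15:36Z free-stub list; after Defs III″
p728234 and the `…GenusLabelsLevel` ∕ `…GenusLabelsOddSupply` helpers p728813 ∕ p729065).

WHY.  The [J] Prop. 4.7 clause of the class-data child `GenusLine.GenusClassDataSupply` is served BY NAME by corner3-p2's producer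
`ShimuraWalk.addOrderOf_localization_kolyvaginClass_familyData_eq_of_labels` (file `…ShimuraFamilyH47Orders`), whose interface asks for
the FULL printed labels `LabelsAt W N K ι yK ys ε` at the conductor `N = N_W`, although its proof reads the (B4)/(B5) clauses only at the
levels dividing `nℓ` — square-free products of Kolyvagin primes, which avoid `N` AND are odd.  On the genus line the labels are supplied
OFF `2N_W` only (`GenusLine.GenusLabelsSupplyOdd`, Defs III″ §6; the even inert levels are out of reach of the twist transport at `ℓ = 2`),
so the producer is re-run here with the labels at ANY guard `N'` avoided by the prime factors of `nℓ` (`hKolN'`): statement and proof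
VERBATIM loc. cit. (p604141-era text), with `hL : LabelsAt W N' …` and the two reads of `hL` guarded by `¬ q ∣ N'` instead of `¬ q ∣ N`.
For `N' = N` and `hKolN' := (hKol q hq).1.2.1` it is literally the original.

RESULTS (namespace `…Theorems.ShimuraWalk`, next to the originals):
* `addOrderOf_localization_kolyvaginClass_familyData_eq_of_labelsGuard` — `htor` shape.
* `addOrderOf_localization_kolyvaginClass_familyData_eq_of_labelsGuard_of_admissible` — `hA` shape, `1 ≤ k`.

HONEST FRAMING. Helper lemmas (adapted copies, credited above); nothing about BSD or any Heegner divisibility is asserted; no stub is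
discharged; no item closes (T7).  [cite: McCallumLMS1991, §4 Prop. 4.4, Cor. 4.5] [cite: Jetchev2008, Prop. 4.10 (ii)]
[cite: GrossLMS1991, Prop. 3.7 (2), §4 (4.4)] presearch: in-tree only (the original producer and its four inputs); no new literature.
-/

set_option autoImplicit false
set_option linter.dupNamespace false

noncomputable section

open scoped Classical

namespace Summit.BirchSwinnertonDyer.BirchSwinnertonDyer.Theorems.ShimuraWalk


open WeierstrassCurve Field NumberField IsDedekindDomain Finset
  Literature.NumberTheory.EllipticCurves Literature.NumberTheory.GaloisRepresentations
  Literature.NumberTheory.GaloisRepresentations.DiscreteGaloisModule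
  Literature.NumberTheory.EllipticCurves.KolyvaginCocycle
  Literature.NumberTheory.EllipticCurves.RingClassField
  Literature.NumberTheory.EllipticCurves.ModularForms
  Literature.NumberTheory.EllipticCurves.Jetchev2008 Literature.NumberTheory.Automorphic
  Summit.BirchSwinnertonDyer.Rank1Residual.X11b Summit.BirchSwinnertonDyer.Rank1Residual.X11b.Three
  Summit.BirchSwinnertonDyer.Rank1Residual.JET Summit.BirchSwinnertonDyer.Rank1Residual.JET.SelmerVocabulary
  Summit.BirchSwinnertonDyer.Rank1Residual.JET.Walk
  Summit.BirchSwinnertonDyer.BirchSwinnertonDyer.Theorems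

variable {K : Type} [Field K] [NumberField K] {W : WeierstrassCurve ℚ} {ι : K →+* ℂ}

/-- **McCallum 4.4 in ORDER form for arbitrary pairs, labels at a GENERAL GUARD `N'`** (`htor` shape): as
`addOrderOf_localization_kolyvaginClass_familyData_eq_of_labels` with `hL : LabelsAt W N' K ι yK ys ε` for any `N'` avoided by the
prime factors of `n' = nℓ` (`hKolN'`). [cite: McCallumLMS1991, §4 Prop. 4.4, Cor. 4.5] [cite: Jetchev2008, Prop. 4.10 (ii)]
[cite: GrossLMS1991, Prop. 3.7 (2), §4 (4.4)] -/
theorem addOrderOf_localization_kolyvaginClass_familyData_eq_of_labelsGuard {N : ℕ} [NeZero N] [W.IsElliptic] [W.IsGloballyMinimal]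
    (hK : IsImaginaryQuadratic K) (hD : NumberField.discr K < -4) (ι : K →+* ℂ) (hN : W.conductorNorm ℤ = N)
    {p : ℕ} [Fact p.Prime] (hp2 : p ≠ 2) (Dt : ModularParametrizationData W N) [∀ j : ℕ, NumberField (ringClassField K ι j)]
    (htor : ∀ m : ℕ, m ≠ 0 → ¬ p ∣ m →
      ∀ (n' : ℕ) (a : (W.baseChange (ringClassField K ι m)).toAffine.Point), ((p ^ n' : ℕ) : ℤ) • a = 0 → a = 0)
    (ys : (m : ℕ) → (W.baseChange (ringClassField K ι m)).toAffine.Point)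
    {yK : (W.baseChange K).toAffine.Point} {ε : ℤ} {N' : ℕ} (hL : LabelsAt W N' K ι yK ys ε)
    (k n n' : ℕ) (d : KolyvaginFamilyData W K ι n) (d' : KolyvaginFamilyData W K ι n') (ℓ : ℕ)
    (hdy : d.y = ys n) (hd'y : d'.y = ys n') (hn : Squarefree n)
    (hKol : ∀ q ∈ n'.primeFactors, IsKolyvaginPrime N W K p q ∧ FrobEqFrobInfty W K (p ^ k) q)
    (hℓ : ℓ.Prime) (hℓn : ¬ ℓ ∣ n) (hn' : n' = n * ℓ) (hKolN' : ∀ q ∈ n'.primeFactors, ¬ q ∣ N')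
    (v : HeightOneSpectrum (𝓞 K)) (hv : (ℓ : 𝓞 K) ∈ v.asIdeal) :
    addOrderOf (galoisCohomology.localization ((W.baseChange K).torsionGaloisModule ((p ^ k : ℕ) : ℤ)) (Sum.inr v) 1
        (d'.kolyvaginClass (Fact.out : p.Prime) k)) =
      addOrderOf (galoisCohomology.localization ((W.baseChange K).torsionGaloisModule ((p ^ k : ℕ) : ℤ)) (Sum.inr v) 1
        (d.kolyvaginClass (Fact.out : p.Prime) k)) := by
  subst hn'
  have hp : p.Prime := Fact.out
  set loc := galoisCohomology.localization ((W.baseChange K).torsionGaloisModule ((p ^ k : ℕ) : ℤ)) (Sum.inr v) 1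
    with hloc
  have hkill : ∀ z : galH1Torsion (W.baseChange K) ((p ^ k : ℕ) : ℤ), p ^ k • z = 0 := fun z ↦ by
    rw [← natCast_zsmul]; exact zsmul_galH1Torsion_eq_zero (W.baseChange K) _ z
  -- the level `k = 0`: `H¹(K, E[1]) = 0`
  rcases Nat.eq_zero_or_pos k with rfl | hkpos
  · have h0 : ∀ z : galH1Torsion (W.baseChange K) ((p ^ 0 : ℕ) : ℤ), z = 0 := fun z ↦ by
      simpa only [pow_zero, one_smul] using hkill z
    rw [h0 (d'.kolyvaginClass hp 0), h0 (d.kolyvaginClass hp 0)]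
  have hk : 1 ≤ k := hkpos
  -- the level `nℓ`
  have hcop : n.Coprime ℓ := (Nat.Coprime.symm ((Nat.Prime.coprime_iff_not_dvd hℓ).mpr hℓn))
  have hnℓ : Squarefree (n * ℓ) := (Nat.squarefree_mul hcop).mpr ⟨hn, hℓ.prime.squarefree⟩
  have hnℓ0 : n * ℓ ≠ 0 := hnℓ.ne_zero
  have hℓmem : ℓ ∈ (n * ℓ).primeFactors := Nat.mem_primeFactors.mpr ⟨hℓ, dvd_mul_left ℓ n, hnℓ0⟩
  have hndvd : n ∣ n * ℓ := dvd_mul_right n ℓ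
  have hdiv : n * ℓ / ℓ = n := Nat.mul_div_cancel n hℓ.pos
  have hKolN : ∀ q ∈ (n * ℓ).primeFactors, IsKolyvaginPrime (W.conductorNorm ℤ) W K p q := fun q hq ↦ hN ▸ (hKol q hq).1
  have hguard : ∀ q ∈ (n * ℓ).primeFactors, ¬ q ∣ N ∧ (Ideal.span {(q : 𝓞 K)}).IsPrime :=
    fun q hq ↦ ⟨(hKol q hq).1.2.1, (hKol q hq).1.2.2.2.2.1⟩
  have hguard' : ∀ q ∈ (n * ℓ).primeFactors, ¬ q ∣ N' ∧ (Ideal.span {(q : 𝓞 K)}).IsPrime :=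
    fun q hq ↦ ⟨hKolN' q hq, (hKol q hq).1.2.2.2.2.1⟩
  have hℓZ : Zhang2014.IsKolyvaginPrime (W.conductorNorm ℤ) W K p ℓ :=
    (Summit.BirchSwinnertonDyer.Rank1Residual.X11b.Three.Koly.zhang_isKolyvaginPrime_of_frobEqFrobInfty (W := W) (K := K)
      hp hk (hKolN ℓ hℓmem) (hKol ℓ hℓmem).2).1
  have hkM : (k : ℕ∞) ≤ frobLevelIndex W K p (n * ℓ) :=
    (natCast_le_frobLevelIndex_iff hKolN k).mpr fun q hq ↦ (hKol q hq).2
  -- (i) a coherent family on the divisors of `nℓ` with `D.y = ys`, its labels and admissibility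
  obtain ⟨D, hDy, -, hcoh⟩ := exists_coherent_familyData_y_eq (W := W) hK ι hnℓ (fun q hq ↦ (hguard q hq).2) ys
  obtain ⟨hB4d, hB5d, -⟩ := familyLabels_of_labelsAt (W := W) hnℓ hguard' ys hL D hDy
  have hA : ∀ (m : ℕ) (hm : m ∣ n * ℓ), IsAdmissible (absoluteGaloisGroup K) (D m hm).pointsSubgroup ((p ^ k : ℕ) : ℤ) := by
    intro m hm
    have hm0 : m ≠ 0 := ne_zero_of_dvd_ne_zero hnℓ0 hm
    have hpm : ¬ p ∣ m := fun h ↦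
      (hKol p (Nat.primeFactors_mono hm hnℓ0 (Nat.mem_primeFactors.mpr ⟨hp, h, hm0⟩))).1.2.2.2.1 rfl
    exact isAdmissible_pointsSubgroup_familyData hK (D m hm) (htor m hm0 hpm)
  have hkey := keyRelation_familyData_of_labels hK ι hN hp hp2 hk Dt hnℓ hKol D hcoh hB4d hB5d hA (n * ℓ) dvd_rfl ℓ hℓmem v hv
  -- re-index the lower datum from `nℓ/ℓ` to `n`
  have hidx : ∀ (x : ℕ) (hx : x ∣ n * ℓ), x = n → ∀ a : ℕ,
      ((((p : ℤ) ^ a) • (D x hx).kolyvaginClass hp k ∈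
          (W.baseChange K).torsionLocalKer (v.adicCompletion K) ((p ^ k : ℕ) : ℤ)) ↔
        (((p : ℤ) ^ a) • (D n hndvd).kolyvaginClass hp k ∈
          (W.baseChange K).torsionLocalKer (v.adicCompletion K) ((p ^ k : ℕ) : ℤ))) := by
    rintro x hx rfl a; exact Iff.rfl
  -- (ii) the class at level `nℓ` is transverse at `ℓ`
  have htrv : (D (n * ℓ) dvd_rfl).kolyvaginClass hp k ∈ transverseKer W K ι ((p ^ k : ℕ) : ℤ) ℓ :=
    kolyvaginClass_familyData_mem_transverseKer W hK hD hp2 ι k hnℓ hKolN hkM (D (n * ℓ) dvd_rfl) hℓmem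
  -- (iii) the coherent pair has equal local orders
  have hcohord : addOrderOf (loc ((D (n * ℓ) dvd_rfl).kolyvaginClass hp k)) =
      addOrderOf (loc ((D n hndvd).kolyvaginClass hp k)) := by
    refine addOrderOf_eq_of_forall_pow_smul_eq_zero_iff (p := p) (k := k) hp
      (by rw [← map_nsmul]; exact (congrArg loc (hkill _)).trans (map_zero loc))
      (by rw [← map_nsmul]; exact (congrArg loc (hkill _)).trans (map_zero loc)) fun a ↦ ?_
    rw [hloc, localization_pow_smul_eq_zero_iff_mem_torsionLocalKer (W := W) hp v ((D (n * ℓ) dvd_rfl).kolyvaginClass hp k) a,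
      localization_pow_smul_eq_zero_iff_mem_torsionLocalKer (W := W) hp v ((D n hndvd).kolyvaginClass hp k) a,
      ← mem_selmerLocalKer_iff_mem_torsionLocalKer_of_mem_transverseKer (W := W) hK hD ι k hℓZ v hv
        (((p : ℤ) ^ a) • (D (n * ℓ) dvd_rfl).kolyvaginClass hp k)
        ((transverseKer W K ι ((p ^ k : ℕ) : ℤ) ℓ).zsmul_mem htrv ((p : ℤ) ^ a)),
      hkey a, hidx (n * ℓ / ℓ) _ hdiv a]
  -- (iv) choice-freeness: transport to `d'` and `d`
  have hB4top : ∀ (m : ℕ), m ∣ n * ℓ → ∀ x ∈ m.primeFactors, ∀ σ : ringClassField K ι m ≃ₐ[ℚ] ringClassField K ι m,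
      Subgroup.zpowers σ = ringClassGalOver ι m (m / x) →
      ∃ y' : (W.baseChange (ringClassField K ι m)).toAffine.Point,
        ∑ i ∈ Finset.range (x + 1), pointGalHom W (ringClassField K ι m) (σ ^ i) (ys m) = W.frobeniusTrace x • y' := by
    intro m hm x hx σ hσ
    have hm0 : m ≠ 0 := ne_zero_of_dvd_ne_zero hnℓ0 hm
    letI : Algebra K ℂ := ι.toAlgebra
    exact ⟨_, hL.2.2.2.2.1 m (hnℓ.squarefree_of_dvd hm) (fun q hq ↦ hguard' q (Nat.primeFactors_mono hm hnℓ0 hq)) x hx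
      (ringClassField_mono hK ι (Nat.div_dvd_of_dvd (Nat.dvd_of_mem_primeFactors hx)) hm0) σ hσ⟩
  have hKolk : ∀ (m : ℕ), m ∣ n * ℓ → ∀ q ∈ m.primeFactors, IsKolyvaginPrime N W K p q ∧ FrobEqFrobInfty W K (p ^ k) q :=
    fun m hm q hq ↦ hKol q (Nat.primeFactors_mono hm hnℓ0 hq)
  have htop : addOrderOf (loc (d'.kolyvaginClass hp k)) = addOrderOf (loc ((D (n * ℓ) dvd_rfl).kolyvaginClass hp k)) :=
    addOrderOf_map_kolyvaginClass_eq (W := W) hK ι Dt hp hk hnℓ (hKolk _ dvd_rfl) (D (n * ℓ) dvd_rfl) d'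
      (by rw [hd'y, hDy]) (by rw [hDy]; exact hB4top _ dvd_rfl) loc
  have hbot : addOrderOf (loc (d.kolyvaginClass hp k)) = addOrderOf (loc ((D n hndvd).kolyvaginClass hp k)) :=
    addOrderOf_map_kolyvaginClass_eq (W := W) hK ι Dt hp hk hn (hKolk _ hndvd) (D n hndvd) d
      (by rw [hdy, hDy]) (by rw [hDy]; exact hB4top _ hndvd) loc
  rw [htop, hbot, hcohord]

/-- **McCallum 4.4 in ORDER form for arbitrary pairs, labels at a GENERAL GUARD `N'`, admissibility in the ∀-datum shape `hA`**
(`1 ≤ k`): as `addOrderOf_localization_kolyvaginClass_familyData_eq_of_labels_of_admissible` with `hL : LabelsAt W N' …` and `hKolN'`.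
[cite: McCallumLMS1991, §4 Prop. 4.4, Cor. 4.5] [cite: Jetchev2008, Prop. 4.10 (ii)] [cite: GrossLMS1991, Prop. 3.7 (2), §4 (4.4)] -/
theorem addOrderOf_localization_kolyvaginClass_familyData_eq_of_labelsGuard_of_admissible {N : ℕ} [NeZero N] [W.IsElliptic] [W.IsGloballyMinimal]
    (hK : IsImaginaryQuadratic K) (hD : NumberField.discr K < -4) (ι : K →+* ℂ) (hN : W.conductorNorm ℤ = N)
    {p : ℕ} [Fact p.Prime] (hp2 : p ≠ 2) (Dt : ModularParametrizationData W N) [∀ j : ℕ, NumberField (ringClassField K ι j)]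
    (ys : (m : ℕ) → (W.baseChange (ringClassField K ι m)).toAffine.Point)
    {yK : (W.baseChange K).toAffine.Point} {ε : ℤ} {N' : ℕ} (hL : LabelsAt W N' K ι yK ys ε)
    (hA : ∀ (m : ℕ) (dm : KolyvaginFamilyData W K ι m), dm.y = ys m → Squarefree m →
      (∀ q ∈ m.primeFactors, IsKolyvaginPrime N W K p q) →
      ∀ j : ℕ, IsAdmissible (absoluteGaloisGroup K) dm.pointsSubgroup ((p ^ j : ℕ) : ℤ))
    (k n n' : ℕ) (d : KolyvaginFamilyData W K ι n) (d' : KolyvaginFamilyData W K ι n') (ℓ : ℕ)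
    (hk : 1 ≤ k) (hdy : d.y = ys n) (hd'y : d'.y = ys n') (hn : Squarefree n)
    (hKol : ∀ q ∈ n'.primeFactors, IsKolyvaginPrime N W K p q ∧ FrobEqFrobInfty W K (p ^ k) q)
    (hℓ : ℓ.Prime) (hℓn : ¬ ℓ ∣ n) (hn' : n' = n * ℓ) (hKolN' : ∀ q ∈ n'.primeFactors, ¬ q ∣ N')
    (v : HeightOneSpectrum (𝓞 K)) (hv : (ℓ : 𝓞 K) ∈ v.asIdeal) :
    addOrderOf (galoisCohomology.localization ((W.baseChange K).torsionGaloisModule ((p ^ k : ℕ) : ℤ)) (Sum.inr v) 1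
        (d'.kolyvaginClass (Fact.out : p.Prime) k)) =
      addOrderOf (galoisCohomology.localization ((W.baseChange K).torsionGaloisModule ((p ^ k : ℕ) : ℤ)) (Sum.inr v) 1
        (d.kolyvaginClass (Fact.out : p.Prime) k)) := by
  subst hn'
  have hp : p.Prime := Fact.out
  set loc := galoisCohomology.localization ((W.baseChange K).torsionGaloisModule ((p ^ k : ℕ) : ℤ)) (Sum.inr v) 1
    with hloc
  have hkill : ∀ z : galH1Torsion (W.baseChange K) ((p ^ k : ℕ) : ℤ), p ^ k • z = 0 := fun z ↦ by
    rw [← natCast_zsmul]; exact zsmul_galH1Torsion_eq_zero (W.baseChange K) _ z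
  -- the level `nℓ`
  have hcop : n.Coprime ℓ := (Nat.Coprime.symm ((Nat.Prime.coprime_iff_not_dvd hℓ).mpr hℓn))
  have hnℓ : Squarefree (n * ℓ) := (Nat.squarefree_mul hcop).mpr ⟨hn, hℓ.prime.squarefree⟩
  have hnℓ0 : n * ℓ ≠ 0 := hnℓ.ne_zero
  have hℓmem : ℓ ∈ (n * ℓ).primeFactors := Nat.mem_primeFactors.mpr ⟨hℓ, dvd_mul_left ℓ n, hnℓ0⟩
  have hndvd : n ∣ n * ℓ := dvd_mul_right n ℓ
  have hdiv : n * ℓ / ℓ = n := Nat.mul_div_cancel n hℓ.pos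
  have hKolN : ∀ q ∈ (n * ℓ).primeFactors, IsKolyvaginPrime (W.conductorNorm ℤ) W K p q := fun q hq ↦ hN ▸ (hKol q hq).1
  have hguard : ∀ q ∈ (n * ℓ).primeFactors, ¬ q ∣ N ∧ (Ideal.span {(q : 𝓞 K)}).IsPrime :=
    fun q hq ↦ ⟨(hKol q hq).1.2.1, (hKol q hq).1.2.2.2.2.1⟩
  have hguard' : ∀ q ∈ (n * ℓ).primeFactors, ¬ q ∣ N' ∧ (Ideal.span {(q : 𝓞 K)}).IsPrime :=
    fun q hq ↦ ⟨hKolN' q hq, (hKol q hq).1.2.2.2.2.1⟩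
  have hℓZ : Zhang2014.IsKolyvaginPrime (W.conductorNorm ℤ) W K p ℓ :=
    (Summit.BirchSwinnertonDyer.Rank1Residual.X11b.Three.Koly.zhang_isKolyvaginPrime_of_frobEqFrobInfty (W := W) (K := K)
      hp hk (hKolN ℓ hℓmem) (hKol ℓ hℓmem).2).1
  have hkM : (k : ℕ∞) ≤ frobLevelIndex W K p (n * ℓ) :=
    (natCast_le_frobLevelIndex_iff hKolN k).mpr fun q hq ↦ (hKol q hq).2
  -- (i) a coherent family on the divisors of `nℓ` with `D.y = ys`, its labels and admissibility
  obtain ⟨D, hDy, -, hcoh⟩ := exists_coherent_familyData_y_eq (W := W) hK ι hnℓ (fun q hq ↦ (hguard q hq).2) ys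
  obtain ⟨hB4d, hB5d, -⟩ := familyLabels_of_labelsAt (W := W) hnℓ hguard' ys hL D hDy
  have hA' : ∀ (m : ℕ) (hm : m ∣ n * ℓ), IsAdmissible (absoluteGaloisGroup K) (D m hm).pointsSubgroup ((p ^ k : ℕ) : ℤ) :=
    fun m hm ↦ hA m (D m hm) (hDy m hm) (hnℓ.squarefree_of_dvd hm)
      (fun q hq ↦ (hKol q (Nat.primeFactors_mono hm hnℓ0 hq)).1) k
  have hkey := keyRelation_familyData_of_labels hK ι hN hp hp2 hk Dt hnℓ hKol D hcoh hB4d hB5d hA' (n * ℓ) dvd_rfl ℓ hℓmem v hv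
  -- re-index the lower datum from `nℓ/ℓ` to `n`
  have hidx : ∀ (x : ℕ) (hx : x ∣ n * ℓ), x = n → ∀ a : ℕ,
      ((((p : ℤ) ^ a) • (D x hx).kolyvaginClass hp k ∈
          (W.baseChange K).torsionLocalKer (v.adicCompletion K) ((p ^ k : ℕ) : ℤ)) ↔
        (((p : ℤ) ^ a) • (D n hndvd).kolyvaginClass hp k ∈
          (W.baseChange K).torsionLocalKer (v.adicCompletion K) ((p ^ k : ℕ) : ℤ))) := by
    rintro x hx rfl a; exact Iff.rfl
  -- (ii) the class at level `nℓ` is transverse at `ℓ`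
  have htrv : (D (n * ℓ) dvd_rfl).kolyvaginClass hp k ∈ transverseKer W K ι ((p ^ k : ℕ) : ℤ) ℓ :=
    kolyvaginClass_familyData_mem_transverseKer W hK hD hp2 ι k hnℓ hKolN hkM (D (n * ℓ) dvd_rfl) hℓmem
  -- (iii) the coherent pair has equal local orders
  have hcohord : addOrderOf (loc ((D (n * ℓ) dvd_rfl).kolyvaginClass hp k)) =
      addOrderOf (loc ((D n hndvd).kolyvaginClass hp k)) := by
    refine addOrderOf_eq_of_forall_pow_smul_eq_zero_iff (p := p) (k := k) hp
      (by rw [← map_nsmul]; exact (congrArg loc (hkill _)).trans (map_zero loc))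
      (by rw [← map_nsmul]; exact (congrArg loc (hkill _)).trans (map_zero loc)) fun a ↦ ?_
    rw [hloc, localization_pow_smul_eq_zero_iff_mem_torsionLocalKer (W := W) hp v ((D (n * ℓ) dvd_rfl).kolyvaginClass hp k) a,
      localization_pow_smul_eq_zero_iff_mem_torsionLocalKer (W := W) hp v ((D n hndvd).kolyvaginClass hp k) a,
      ← mem_selmerLocalKer_iff_mem_torsionLocalKer_of_mem_transverseKer (W := W) hK hD ι k hℓZ v hv
        (((p : ℤ) ^ a) • (D (n * ℓ) dvd_rfl).kolyvaginClass hp k)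
        ((transverseKer W K ι ((p ^ k : ℕ) : ℤ) ℓ).zsmul_mem htrv ((p : ℤ) ^ a)),
      hkey a, hidx (n * ℓ / ℓ) _ hdiv a]
  -- (iv) choice-freeness: transport to `d'` and `d`
  have hB4top : ∀ (m : ℕ), m ∣ n * ℓ → ∀ x ∈ m.primeFactors, ∀ σ : ringClassField K ι m ≃ₐ[ℚ] ringClassField K ι m,
      Subgroup.zpowers σ = ringClassGalOver ι m (m / x) →
      ∃ y' : (W.baseChange (ringClassField K ι m)).toAffine.Point,
        ∑ i ∈ Finset.range (x + 1), pointGalHom W (ringClassField K ι m) (σ ^ i) (ys m) = W.frobeniusTrace x • y' := by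
    intro m hm x hx σ hσ
    have hm0 : m ≠ 0 := ne_zero_of_dvd_ne_zero hnℓ0 hm
    letI : Algebra K ℂ := ι.toAlgebra
    exact ⟨_, hL.2.2.2.2.1 m (hnℓ.squarefree_of_dvd hm) (fun q hq ↦ hguard' q (Nat.primeFactors_mono hm hnℓ0 hq)) x hx
      (ringClassField_mono hK ι (Nat.div_dvd_of_dvd (Nat.dvd_of_mem_primeFactors hx)) hm0) σ hσ⟩
  have hKolk : ∀ (m : ℕ), m ∣ n * ℓ → ∀ q ∈ m.primeFactors, IsKolyvaginPrime N W K p q ∧ FrobEqFrobInfty W K (p ^ k) q :=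
    fun m hm q hq ↦ hKol q (Nat.primeFactors_mono hm hnℓ0 hq)
  have htop : addOrderOf (loc (d'.kolyvaginClass hp k)) = addOrderOf (loc ((D (n * ℓ) dvd_rfl).kolyvaginClass hp k)) :=
    addOrderOf_map_kolyvaginClass_eq (W := W) hK ι Dt hp hk hnℓ (hKolk _ dvd_rfl) (D (n * ℓ) dvd_rfl) d'
      (by rw [hd'y, hDy]) (by rw [hDy]; exact hB4top _ dvd_rfl) loc
  have hbot : addOrderOf (loc (d.kolyvaginClass hp k)) = addOrderOf (loc ((D n hndvd).kolyvaginClass hp k)) :=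
    addOrderOf_map_kolyvaginClass_eq (W := W) hK ι Dt hp hk hn (hKolk _ hndvd) (D n hndvd) d
      (by rw [hdy, hDy]) (by rw [hDy]; exact hB4top _ hndvd) loc
  rw [htop, hbot, hcohord]

end Summit.BirchSwinnertonDyer.BirchSwinnertonDyer.Theorems.ShimuraWalk

end
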